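import Summits.KontsevichZagierPeriods.KontsevichZagierPeriods.Theorems.UnfoldedStokesStokesGenerationFibrewiseRungReparam
import Summits.KontsevichZagierPeriods.KontsevichZagierPeriods.Theorems.UnfoldedStokesStokesGenerationFibrewiseClosureCongr
import Literature.NumberTheory.Transcendental.SemialgebraicMapsProofs
import Mathlib.Analysis.SpecialFunctions.Sqrt

/-!
# `StokesGeneration` (stmt-KontsevichZagierPeriods-3586) — line `fibrewise_stokes`, stub `stub_anchorSq`

Registered stub A2a (RUNG A — the anchor `π²`, wave 8, lead c6) of the line `fibrewise_stokes` of the crux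
`StokesGeneration` (route UnfoldedStokes; residual S2 `FibStokesDecomposable`, `Theorems/UnfoldedStokesDefs.lean`):
**the square reparametrisation `w̃ = v²` of piece 2 of the anchor integrand.** With the cut profile
`φ(y) = (1 + y)/(√(2 − y²)(1 + √(2 − y²))) ∈ (0, 1]` on `[0,1]` and the bounded kernel
`k₁(w,y) = 4/((1 + yw)(1 + y − y(1 − y)w))` (value `π²/4` on the square), the integrand of piece 2 is
`f(x₀,x₁) = φ(x₁) k₁(φ(x₁)x₀, x₁)`, and the theorem is that the change-of-variables relator
`f(x) − f(x[0 ↦ x₀²]) · 2x₀` of the fibrewise reparametrisation `ψ(x) = x₀²` of the first coordinate is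
fibrewise-Stokes decomposable on `[0,1]²`.

Proof: the landed rung 13 `fibStokesDecomposable_sub_reparam` (Kontsevich–Zagier's rule (2) for a fibrewise
face-fixing `C¹` reparametrisation of one coordinate) along `a = 0` with `ψ(x) = x₀²`, `ψₐ(x) = 2x₀`
(`ψ = 0` on `{x₀ = 0}`, `ψ = 1` on `{x₀ = 1}`, `0 < ψ < 1` between). The data are as rung 13 wants them on the
closed square: `1 ≤ √(2 − y²)` for `y ∈ [0,1]`, so `φ` is a quotient of `ℚ`-semialgebraic continuous functions
by a denominator `≥ 2` (one square root of a polynomial, `IsSemialgebraicFunOn.fun_sqrt`), `0 < φ ≤ 1`, hence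
`w = φ(x₁)x₀ ∈ [0,1]` and both factors of the denominator of `k₁` are `≥ 1` on the square; `f` and its fibre
derivative `fₐ(x) = −8x₁²φ²(1 − (1 − x₁)φx₀)/((1 + x₁φx₀)(1 + x₁ − x₁(1 − x₁)φx₀))²` are therefore
`ℚ`-semialgebraic (dot-lemmas) and continuous on the square, and `HasDerivAt` is the quotient rule. Finally the
registered right-hand side is rung 13's relator letter by letter (`fibStokesDecomposable_congr_off_null` with the
empty null set, `ring`). Transcendence-free and value-free.

References: M. Kontsevich, D. Zagier, *Periods* (2001), §1.1 (the example `ζ(2) = π²/6`), §1.2 rules (2), (3);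
J. Bochnak, M. Coste, M.-F. Roy, *Real Algebraic Geometry* (1998), Prop. 2.2.6.
-/

noncomputable section

-- `Summit.KontsevichZagierPeriods.KontsevichZagierPeriods.…` is the tree's mandated layout (single-conjunct summit).
set_option linter.dupNamespace false

namespace Summit.KontsevichZagierPeriods.KontsevichZagierPeriods.Cruxes.StokesGeneration.FibrewiseStokes

open MeasureTheory Set
open Literature.NumberTheory.Transcendental
open Literature.NumberTheory.Transcendental.KZ
open Literature.ModelTheory.ExponentialFields (IsSemialgebraic)

/-- Bounds for the cut profile `φ(y) = (1 + y)/(√(2 − y²)(1 + √(2 − y²)))` on `[0,1]`: `1 ≤ √(2 − y²)` and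
`0 < φ(y) ≤ 1`. [folklore] -/
private theorem anchorSq_phi_bounds {y : ℝ} (hy : y ∈ Set.Icc (0:ℝ) 1) :
    1 ≤ Real.sqrt (2 - y ^ 2) ∧
      0 < (1 + y) / (Real.sqrt (2 - y ^ 2) * (1 + Real.sqrt (2 - y ^ 2))) ∧
      (1 + y) / (Real.sqrt (2 - y ^ 2) * (1 + Real.sqrt (2 - y ^ 2))) ≤ 1 := by
  have hy2 : y ^ 2 ≤ y := by nlinarith [hy.1, hy.2]
  have hR : 1 ≤ Real.sqrt (2 - y ^ 2) := Real.one_le_sqrt.2 (by linarith [hy.2])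
  have hR2 : Real.sqrt (2 - y ^ 2) ^ 2 = 2 - y ^ 2 := Real.sq_sqrt (by linarith [hy.2])
  have hden : 0 < Real.sqrt (2 - y ^ 2) * (1 + Real.sqrt (2 - y ^ 2)) :=
    mul_pos (by linarith) (by linarith)
  refine ⟨hR, div_pos (by linarith [hy.1]) hden, (div_le_one hden).2 ?_⟩
  have e : Real.sqrt (2 - y ^ 2) * (1 + Real.sqrt (2 - y ^ 2)) =
      Real.sqrt (2 - y ^ 2) + Real.sqrt (2 - y ^ 2) ^ 2 := by ring
  rw [e, hR2]
  linarith [hy.2]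

/-- **Registered stub `stub_anchorSq` (A2a, RUNG A): the square reparametrisation of piece 2 of the anchor.**
With `φ(y) = (1 + y)/(√(2 − y²)(1 + √(2 − y²)))` and `k₁(w,y) = 4/((1 + yw)(1 + y − y(1 − y)w))`, the relator
`f(x) − f(x[0 ↦ x₀²]) · 2x₀` of the bounded smooth integrand `f(x) = φ(x₁) k₁(φ(x₁)x₀, x₁)` under `x₀ ↦ x₀²`
is fibrewise-Stokes decomposable on `[0,1]²`: rung 13 (`fibStokesDecomposable_sub_reparam`) along the first
coordinate with `ψ = x₀²`, `ψₐ = 2x₀`. [cite: KontsevichZagier2001, §1.2 rules (2), (3)] -/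
theorem stub_anchorSq :
    FibStokesDecomposable 2 (fun z =>
      (1 + z 1) / (Real.sqrt (2 - z 1 ^ 2) * (1 + Real.sqrt (2 - z 1 ^ 2))) *
        (4 / ((1 + z 1 * ((1 + z 1) / (Real.sqrt (2 - z 1 ^ 2) * (1 + Real.sqrt (2 - z 1 ^ 2))) * z 0)) *
          (1 + z 1 - z 1 * (1 - z 1) *
            ((1 + z 1) / (Real.sqrt (2 - z 1 ^ 2) * (1 + Real.sqrt (2 - z 1 ^ 2))) * z 0)))) -
      2 * z 0 * ((1 + z 1) / (Real.sqrt (2 - z 1 ^ 2) * (1 + Real.sqrt (2 - z 1 ^ 2))) *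
        (4 / ((1 + z 1 * ((1 + z 1) / (Real.sqrt (2 - z 1 ^ 2) * (1 + Real.sqrt (2 - z 1 ^ 2))) * z 0 ^ 2)) *
          (1 + z 1 - z 1 * (1 - z 1) *
            ((1 + z 1) / (Real.sqrt (2 - z 1 ^ 2) * (1 + Real.sqrt (2 - z 1 ^ 2))) * z 0 ^ 2)))))) := by
  set C : Set (Fin 2 → ℝ) := Set.pi Set.univ (fun _ : Fin 2 => Set.Icc (0:ℝ) 1) with hC
  have hCsa : IsSemialgebraic ℚ C := by rw [hC, ← cube_eq_pi]; exact isSemialgebraic_cube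
  have hmem : ∀ x ∈ C, ∀ i, x i ∈ Set.Icc (0:ℝ) 1 := fun x hx i => (Set.mem_univ_pi.mp hx) i
  have h10 : (1 : Fin 2) ≠ 0 := by decide
  -- the cut profile read on the square, `Φ x = φ (x 1)`, and its bounds
  obtain ⟨Φ, hΦ⟩ : ∃ Φ : (Fin 2 → ℝ) → ℝ,
      Φ = fun x => (1 + x 1) / (Real.sqrt (2 - x 1 ^ 2) * (1 + Real.sqrt (2 - x 1 ^ 2))) := ⟨_, rfl⟩
  have hΦu : ∀ x s, Φ (Function.update x 0 s) = Φ x := fun x s => by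
    simp only [hΦ, Function.update_of_ne h10]
  have hR1 : ∀ x ∈ C, 1 ≤ Real.sqrt (2 - x 1 ^ 2) := fun x hx => (anchorSq_phi_bounds (hmem x hx 1)).1
  have hRden : ∀ x ∈ C, Real.sqrt (2 - x 1 ^ 2) * (1 + Real.sqrt (2 - x 1 ^ 2)) ≠ 0 := fun x hx =>
    (mul_pos (by linarith [hR1 x hx]) (by linarith [hR1 x hx])).ne'
  have hΦpos : ∀ x ∈ C, 0 < Φ x := fun x hx => by
    rw [hΦ]; exact (anchorSq_phi_bounds (hmem x hx 1)).2.1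
  have hΦle : ∀ x ∈ C, Φ x ≤ 1 := fun x hx => by
    rw [hΦ]; exact (anchorSq_phi_bounds (hmem x hx 1)).2.2
  -- the two factors of the denominator of `k₁` at `w = Φ x · x 0 ∈ [0,1]` are positive on the square
  have hApos : ∀ x ∈ C, 0 < 1 + x 1 * (Φ x * x 0) := fun x hx => by
    have := mul_nonneg (hmem x hx 1).1 (mul_nonneg (hΦpos x hx).le (hmem x hx 0).1)
    linarith
  have hBpos : ∀ x ∈ C, 0 < 1 + x 1 - x 1 * (1 - x 1) * (Φ x * x 0) := fun x hx => by
    have hw1 : Φ x * x 0 ≤ 1 := mul_le_one₀ (hΦle x hx) (hmem x hx 0).1 (hmem x hx 0).2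
    have hy := hmem x hx 1
    have h1 : 0 ≤ x 1 * (1 - x 1) := mul_nonneg hy.1 (sub_nonneg.2 hy.2)
    have h2 : x 1 * (1 - x 1) * (Φ x * x 0) ≤ x 1 * (1 - x 1) := mul_le_of_le_one_right h1 hw1
    nlinarith [sq_nonneg (x 1)]
  have hDpos : ∀ x ∈ C, 0 < (1 + x 1 * (Φ x * x 0)) * (1 + x 1 - x 1 * (1 - x 1) * (Φ x * x 0)) :=
    fun x hx => mul_pos (hApos x hx) (hBpos x hx)
  -- the integrand `f` of piece 2 and its fibre derivative `fD` along `x 0`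
  obtain ⟨f, hf⟩ : ∃ f : (Fin 2 → ℝ) → ℝ, f = fun x =>
      Φ x * (4 / ((1 + x 1 * (Φ x * x 0)) * (1 + x 1 - x 1 * (1 - x 1) * (Φ x * x 0)))) := ⟨_, rfl⟩
  obtain ⟨fD, hfD⟩ : ∃ fD : (Fin 2 → ℝ) → ℝ, fD = fun x =>
      -(8 * x 1 ^ 2 * Φ x ^ 2 * (1 - (1 - x 1) * (Φ x * x 0))) /
        ((1 + x 1 * (Φ x * x 0)) * (1 + x 1 - x 1 * (1 - x 1) * (Φ x * x 0))) ^ 2 := ⟨_, rfl⟩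
  -- semialgebraicity on the square (dot-lemmas; one square root of a polynomial)
  have hx0 : IsSemialgebraicFunOn ℚ C (fun x => x 0) := isSemialgebraicFunOn_apply hCsa 0
  have hx1 : IsSemialgebraicFunOn ℚ C (fun x => x 1) := isSemialgebraicFunOn_apply hCsa 1
  have h1 : IsSemialgebraicFunOn ℚ C (fun _ => (1:ℝ)) := by
    simpa using isSemialgebraicFunOn_const_natCast hCsa 1
  have h2 : IsSemialgebraicFunOn ℚ C (fun _ => (2:ℝ)) := isSemialgebraicFunOn_const_ofNat hCsa 2
  have h4 : IsSemialgebraicFunOn ℚ C (fun _ => (4:ℝ)) := isSemialgebraicFunOn_const_ofNat hCsa 4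
  have h8 : IsSemialgebraicFunOn ℚ C (fun _ => (8:ℝ)) := isSemialgebraicFunOn_const_ofNat hCsa 8
  have hRsa : IsSemialgebraicFunOn ℚ C (fun x => Real.sqrt (2 - x 1 ^ 2)) :=
    (h2.fun_sub (hx1.fun_pow 2)).fun_sqrt
  have hΦsa : IsSemialgebraicFunOn ℚ C Φ := by
    rw [hΦ]; exact (h1.fun_add hx1).div (hRsa.fun_mul (h1.fun_add hRsa)) hRden
  have hwsa : IsSemialgebraicFunOn ℚ C (fun x => Φ x * x 0) := hΦsa.fun_mul hx0
  have hAsa : IsSemialgebraicFunOn ℚ C (fun x => 1 + x 1 * (Φ x * x 0)) := h1.fun_add (hx1.fun_mul hwsa)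
  have hBsa : IsSemialgebraicFunOn ℚ C (fun x => 1 + x 1 - x 1 * (1 - x 1) * (Φ x * x 0)) :=
    (h1.fun_add hx1).fun_sub ((hx1.fun_mul (h1.fun_sub hx1)).fun_mul hwsa)
  have hDsa := hAsa.fun_mul hBsa
  have hfsa : IsSemialgebraicFunOn ℚ C f := by
    rw [hf]; exact hΦsa.fun_mul (h4.div hDsa fun x hx => (hDpos x hx).ne')
  have hfDsa : IsSemialgebraicFunOn ℚ C fD := by
    rw [hfD]
    exact (((h8.fun_mul (hx1.fun_pow 2)).fun_mul (hΦsa.fun_pow 2)).fun_mul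
      (h1.fun_sub ((h1.fun_sub hx1).fun_mul hwsa))).fun_neg.div (hDsa.fun_pow 2)
      fun x hx => pow_ne_zero 2 (hDpos x hx).ne'
  -- continuity on the square
  have hc0 : Continuous fun x : Fin 2 → ℝ => x 0 := continuous_apply 0
  have hc1 : Continuous fun x : Fin 2 → ℝ => x 1 := continuous_apply 1
  have hRc : ContinuousOn (fun x : Fin 2 → ℝ => Real.sqrt (2 - x 1 ^ 2)) C :=
    (continuousOn_const.sub (hc1.continuousOn.pow 2)).sqrt
  have hΦc : ContinuousOn Φ C := by
    rw [hΦ]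
    exact (continuousOn_const.add hc1.continuousOn).div (hRc.mul (continuousOn_const.add hRc)) hRden
  have hwc : ContinuousOn (fun x => Φ x * x 0) C := hΦc.mul hc0.continuousOn
  have hAc : ContinuousOn (fun x => 1 + x 1 * (Φ x * x 0)) C :=
    continuousOn_const.add (hc1.continuousOn.mul hwc)
  have hBc : ContinuousOn (fun x => 1 + x 1 - x 1 * (1 - x 1) * (Φ x * x 0)) C :=
    (continuousOn_const.add hc1.continuousOn).sub
      ((hc1.continuousOn.mul (continuousOn_const.sub hc1.continuousOn)).mul hwc)
  have hDc := hAc.mul hBc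
  have hfc : ContinuousOn f C := by
    rw [hf]; exact hΦc.mul (continuousOn_const.div hDc fun x hx => (hDpos x hx).ne')
  have hfDc : ContinuousOn fD C := by
    rw [hfD]
    exact ((((continuousOn_const.mul (hc1.continuousOn.pow 2)).mul (hΦc.pow 2)).mul
      (continuousOn_const.sub ((continuousOn_const.sub hc1.continuousOn).mul hwc))).neg).div (hDc.pow 2)
      fun x hx => pow_ne_zero 2 (hDpos x hx).ne'
  -- the fibre derivative along `x 0` (quotient rule)
  have hfd : ∀ x ∈ C, x 0 ∈ Set.Ioo (0:ℝ) 1 →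
      HasDerivAt (fun s => f (Function.update x 0 s)) (fD x) (x 0) := by
    intro x hx _
    have e : (fun s => f (Function.update x 0 s)) = fun s =>
        Φ x * (4 / ((1 + x 1 * (Φ x * s)) * (1 + x 1 - x 1 * (1 - x 1) * (Φ x * s)))) := by
      funext s
      simp only [hf, hΦu, Function.update_self, Function.update_of_ne h10]
    rw [e]
    have hs := hasDerivAt_id' (x 0)
    have hA : HasDerivAt (fun s => 1 + x 1 * (Φ x * s)) (x 1 * (Φ x * 1)) (x 0) :=
      ((hs.const_mul (Φ x)).const_mul (x 1)).const_add 1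
    have hB : HasDerivAt (fun s => 1 + x 1 - x 1 * (1 - x 1) * (Φ x * s))
        (-(x 1 * (1 - x 1) * (Φ x * 1))) (x 0) :=
      ((hs.const_mul (Φ x)).const_mul (x 1 * (1 - x 1))).const_sub (1 + x 1)
    have hA0 := (hApos x hx).ne'
    have hB0 := (hBpos x hx).ne'
    have key := (((hasDerivAt_const (x 0) (4:ℝ)).fun_div (hA.fun_mul hB) (hDpos x hx).ne').const_mul (Φ x))
    refine key.congr_deriv ?_
    rw [hfD]
    field_simp
    ring
  -- rung 13 along the first coordinate with `ψ = x₀²`, `ψₐ = 2x₀`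
  have hrel := fibStokesDecomposable_sub_reparam (0 : Fin 2) f fD (fun x => x 0 ^ 2) (fun x => 2 * x 0)
    hfsa hfDsa (hx0.fun_pow 2) (h2.fun_mul hx0) hfc hfDc (hc0.continuousOn.pow 2)
    (continuousOn_const.mul hc0.continuousOn) hfd
    (fun x _ _ => by simpa using hasDerivAt_pow 2 (x 0))
    (fun x _ hx0 => by simp [hx0])
    (fun x _ hx0 => by simp [hx0])
    (fun x _ hx0 => ⟨pow_pos hx0.1 2, pow_lt_one₀ hx0.1.le hx0.2 two_ne_zero⟩)
  refine fibStokesDecomposable_congr_off_null 2 _ _ ∅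
    Literature.ModelTheory.ExponentialFields.isSemialgebraic_empty measure_empty (fun x _ _ => ?_) hrel
  simp only [hf, hΦ, Function.update_self, Function.update_of_ne h10]
  ring

end Summit.KontsevichZagierPeriods.KontsevichZagierPeriods.Cruxes.StokesGeneration.FibrewiseStokes

end
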